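import Mathlib
import HarnessLib

/-!
# The symmetric Beta primitive of Wood's loop: `G₁/(G₁+G₂)` of two independent gammas is Beta — exactly

HONEST FRAMING: exact (Metropolis-corrected) sampling algorithms for lattice gauge theory;
figures of merit are autocorrelation/cost numbers at stated couplings and volumes; no
continuum-physics claim.

Venture `LatticeQCDFlow` (cell pub-lqcd), topic `Exactness`, FANOUT row 9 (eng-latcore, the
engine `latflow.core`).  NEW WORK of the cell over Mathlib (`gammaMeasure`, `betaMeasure`,
`lintegral_image_eq_lintegral_abs_deriv_mul`); nothing here is cited as a fact.  Printed
counterpart, NAMED ONLY: the classical Beta–Gamma relation (e.g. Devroye 1986 §IX.4).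

`WoodSampler.lean` proved the CP(N−1) site heat-bath cosine loop exact GIVEN its `Beta(α, α)` draw
(`α = (d−1)/2`).  The engine produces that draw as `rng_beta_sym(a) = x/(x+y)` with `x, y` two
independent `rng_gamma(a)` variates (`csrc/cpn_kernel.c`; numpy's `rng.beta` on the reference
path).  In idealised real arithmetic, taking the two Gamma(a, 1) draws as primitives:

* `ratioSub y s = y s/(1−s)` — for fixed `y > 0` the inverse of `x ↦ x/(x+y)` on `(0,1) ↔ (0,∞)`
  (`ratioSub_div`, `image_ratioSub`, `hasDerivAt_ratioSub`);
* `lintegral_gammaMeasure_one` — integrating against `gammaMeasure a 1` is integrating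
  `x^{a−1}e^{−x}/Γ(a)` over `(0, ∞)`; `lintegral_Ioi_gammaPDF` — the Gamma density has mass one on
  `(0, ∞)` for every rate (the scaled Gamma integral used to integrate out `x + y`);
* **`lintegral_ratio_gammaMeasure`** — for measurable `g ≥ 0` and `a, b > 0`,
  `∫ g(x/(x+y)) d(Gamma(a,1) ⊗ Gamma(b,1)) = ∫_{(0,1)} s^{a−1}(1−s)^{b−1}/B(a,b) · g(s) ds`;
* **`map_ratio_gammaMeasure_prod`** — THE BETA PRIMITIVE IS EXACT:
  `(gammaMeasure a 1 ⊗ gammaMeasure b 1).map (x,y ↦ x/(x+y)) = betaMeasure a b`; the engine's case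
  is `a = b` (`map_ratio_gammaMeasure_prod_self`).

NOT CLAIMED: the Gamma generator itself (Marsaglia–Tsang; a separate file), floating point.
-/

namespace Summit.Ventures.LatticeQCDFlow.Exactness

open MeasureTheory Measure Set Real ProbabilityTheory
open scoped ENNReal

section BetaGamma

variable {a b : ℝ}

/-! ## §1 The substitution `x = y s/(1−s)` for fixed `y > 0` -/

/-- `ratioSub y s = y s / (1 − s)`: for fixed `y > 0`, the inverse of `x ↦ x/(x+y)`. -/
noncomputable def ratioSub (y s : ℝ) : ℝ := y * s / (1 - s)

/-- `x/(x+y) = s` for `x = ratioSub y s`, `s < 1`, `y > 0`. -/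
theorem ratioSub_div {y s : ℝ} (hy : 0 < y) (hs : s < 1) : ratioSub y s / (ratioSub y s + y) = s := by
  unfold ratioSub
  have h1 : (1 - s) ≠ 0 := by linarith
  have h2 : y * s / (1 - s) + y = y / (1 - s) := by field_simp; ring
  rw [h2, div_div_div_cancel_right₀ h1, mul_div_cancel_left₀ _ hy.ne']

/-- `ratioSub y` maps `(0, 1)` onto `(0, ∞)` for `y > 0`. -/
theorem image_ratioSub {y : ℝ} (hy : 0 < y) : ratioSub y '' Ioo 0 1 = Ioi 0 := by
  ext x
  constructor
  · rintro ⟨s, hs, rfl⟩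
    exact div_pos (mul_pos hy hs.1) (by linarith [hs.2])
  · intro hx
    have hxy : 0 < x + y := by linarith [mem_Ioi.mp hx]
    refine ⟨x / (x + y), ⟨div_pos hx hxy, (div_lt_one hxy).mpr (by linarith)⟩, ?_⟩
    unfold ratioSub
    have h1 : 1 - x / (x + y) = y / (x + y) := by field_simp; ring
    rw [h1, mul_div_assoc', div_div_div_cancel_right₀ hxy.ne', mul_div_cancel_left₀ _ hy.ne']

/-- Derivative of `ratioSub y` at `s ≠ 1`: `y/(1−s)²`. -/
theorem hasDerivAt_ratioSub (y : ℝ) {s : ℝ} (hs : s ≠ 1) :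
    HasDerivAt (ratioSub y) (y / (1 - s) ^ 2) s := by
  have h : HasDerivAt (fun s : ℝ => y * s / (1 - s))
      ((y * 1 * (1 - s) - y * s * (-1)) / (1 - s) ^ 2) s :=
    ((hasDerivAt_id' s).const_mul y).div ((hasDerivAt_id' s).const_sub 1) (sub_ne_zero.mpr hs.symm)
  exact h.congr_deriv (by ring)

/-- `ratioSub y` is injective on `(0,1)` for `y > 0`. -/
theorem injOn_ratioSub {y : ℝ} (hy : 0 < y) : InjOn (ratioSub y) (Ioo 0 1) := by
  intro s hs t ht h
  rw [← ratioSub_div hy hs.2, ← ratioSub_div hy ht.2, h]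

/-- `ratioSub` is jointly measurable. -/
theorem measurable_ratioSub : Measurable fun p : ℝ × ℝ => ratioSub p.1 p.2 := by
  unfold ratioSub; fun_prop

/-! ## §2 Integrating against a Gamma law -/

/-- The Gamma density has mass one on `(0, ∞)` (any shape `a > 0`, any rate `r > 0`). -/
theorem lintegral_Ioi_gammaPDF (ha : 0 < a) {r : ℝ} (hr : 0 < r) : ∫⁻ y in Ioi 0, gammaPDF a r y = 1 := by
  have h := lintegral_gammaPDF_eq_one ha hr
  rw [← lintegral_add_compl _ measurableSet_Ioi, compl_Ioi,
    setLIntegral_congr (Iio_ae_eq_Iic (μ := (volume : Measure ℝ))).symm,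
    lintegral_gammaPDF_of_nonpos le_rfl, add_zero] at h
  exact h

/-- Integrating against `gammaMeasure a 1` is integrating `x^{a−1}e^{−x}/Γ(a)` over `(0, ∞)`. -/
theorem lintegral_gammaMeasure_one (a : ℝ) {G : ℝ → ℝ≥0∞} (hG : Measurable G) :
    ∫⁻ x, G x ∂(gammaMeasure a 1) =
      ∫⁻ x in Ioi 0, ENNReal.ofReal (x ^ (a - 1) * Real.exp (-x) / Real.Gamma a) * G x := by
  have hpdf : Measurable (gammaPDF a 1) := (measurable_gammaPDFReal a 1).ennreal_ofReal
  rw [gammaMeasure, lintegral_withDensity_eq_lintegral_mul _ hpdf hG, ← lintegral_add_compl _ measurableSet_Ici,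
    compl_Ici]
  have h0 : ∫⁻ x in Iio 0, (gammaPDF a 1 * G) x = 0 := by
    rw [setLIntegral_congr_fun measurableSet_Iio (fun x hx => by rw [Pi.mul_apply, gammaPDF_of_neg hx, zero_mul])]
    exact lintegral_zero
  rw [h0, add_zero, setLIntegral_congr (Ioi_ae_eq_Ici (μ := (volume : Measure ℝ))).symm]
  refine setLIntegral_congr_fun measurableSet_Ioi fun x hx => ?_
  rw [Pi.mul_apply, gammaPDF_of_nonneg (le_of_lt hx), one_rpow, one_mul,
    show 1 / Real.Gamma a * x ^ (a - 1) * Real.exp (-x) = x ^ (a - 1) * Real.exp (-x) / Real.Gamma a by ring]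

/-! ## §3 The pointwise identity behind the Beta–Gamma relation -/

/-- For `y > 0`, `0 < s < 1`:
`γ_b(y) · y/(1−s)² · γ_a(ys/(1−s)) = s^{a−1}(1−s)^{b−1}/B(a,b) · γ_{a+b, 1/(1−s)}(y)`. -/
theorem betaGamma_pointwise (ha : 0 < a) (hb : 0 < b) {y s : ℝ} (hy : 0 < y) (hs : s ∈ Ioo (0 : ℝ) 1) :
    (y ^ (b - 1) * Real.exp (-y) / Real.Gamma b) * (y / (1 - s) ^ 2) *
        ((y * s / (1 - s)) ^ (a - 1) * Real.exp (-(y * s / (1 - s))) / Real.Gamma a) =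
      (s ^ (a - 1) * (1 - s) ^ (b - 1) / beta a b) *
        ((1 / (1 - s)) ^ (a + b) / Real.Gamma (a + b) * y ^ (a + b - 1) * Real.exp (-((1 / (1 - s)) * y))) := by
  obtain ⟨hs0, hs1⟩ := hs
  set t := 1 - s with ht
  have ht0 : 0 < t := by rw [ht]; linarith
  have hΓa : 0 < Real.Gamma a := Real.Gamma_pos_of_pos ha
  have hΓb : 0 < Real.Gamma b := Real.Gamma_pos_of_pos hb
  have hΓab : 0 < Real.Gamma (a + b) := Real.Gamma_pos_of_pos (add_pos ha hb)
  -- split the composite powers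
  have h1 : (y * s / t) ^ (a - 1) = y ^ (a - 1) * s ^ (a - 1) / t ^ (a - 1) := by
    rw [Real.div_rpow (mul_nonneg hy.le hs0.le) ht0.le, Real.mul_rpow hy.le hs0.le]
  have h2 : (1 / t) ^ (a + b) = 1 / t ^ (a + b) := by
    rw [Real.div_rpow zero_le_one ht0.le, Real.one_rpow]
  -- the exponentials combine
  have hE : Real.exp (-y) * Real.exp (-(y * s / t)) = Real.exp (-((1 / t) * y)) := by
    rw [← Real.exp_add]
    congr 1
    field_simp
    rw [ht]; ring
  -- the `y`-powers combine
  have hY : y ^ (b - 1) * y * y ^ (a - 1) = y ^ (a + b - 1) := by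
    conv_lhs => rw [show y ^ (b - 1) * y = y ^ (b - 1) * y ^ (1 : ℝ) by rw [Real.rpow_one]]
    rw [← Real.rpow_add hy, ← Real.rpow_add hy]
    congr 1; ring
  -- the `t`-powers combine
  have hT : t ^ (b - 1) * t ^ 2 * t ^ (a - 1) = t ^ (a + b) := by
    rw [show t ^ 2 = t ^ (2 : ℝ) by rw [← Real.rpow_natCast]; norm_num, ← Real.rpow_add ht0,
      ← Real.rpow_add ht0]
    congr 1; ring
  have hbeta : beta a b = Real.Gamma a * Real.Gamma b / Real.Gamma (a + b) := rfl
  rw [h1, h2, hbeta]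
  have hTa : 0 < t ^ (a - 1) := Real.rpow_pos_of_pos ht0 _
  have hTab : 0 < t ^ (a + b) := Real.rpow_pos_of_pos ht0 _
  have hTb : 0 < t ^ (b - 1) := Real.rpow_pos_of_pos ht0 _
  -- reduce both sides to the common form `y^{a+b-1} s^{a-1} e^{-y/t} × (t-powers) / (Γa Γb)`
  calc y ^ (b - 1) * Real.exp (-y) / Real.Gamma b * (y / t ^ 2) *
        (y ^ (a - 1) * s ^ (a - 1) / t ^ (a - 1) * Real.exp (-(y * s / t)) / Real.Gamma a)
      = (y ^ (b - 1) * y * y ^ (a - 1)) * s ^ (a - 1) * (Real.exp (-y) * Real.exp (-(y * s / t))) /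
          (t ^ 2 * t ^ (a - 1)) / (Real.Gamma a * Real.Gamma b) := by
        field_simp
    _ = y ^ (a + b - 1) * s ^ (a - 1) * Real.exp (-((1 / t) * y)) / (t ^ 2 * t ^ (a - 1)) /
          (Real.Gamma a * Real.Gamma b) := by rw [hY, hE]
    _ = y ^ (a + b - 1) * s ^ (a - 1) * Real.exp (-((1 / t) * y)) * t ^ (b - 1) / t ^ (a + b) /
          (Real.Gamma a * Real.Gamma b) := by
        rw [← hT]
        field_simp
    _ = s ^ (a - 1) * t ^ (b - 1) / (Real.Gamma a * Real.Gamma b / Real.Gamma (a + b)) *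
          (1 / t ^ (a + b) / Real.Gamma (a + b) * y ^ (a + b - 1) * Real.exp (-((1 / t) * y))) := by
        field_simp

/-! ## §4 The law of `x/(x+y)` -/

/-- SFinite instance for Mathlib's Gamma law (a density over Lebesgue measure). -/
instance sFinite_gammaMeasure (a r : ℝ) : SFinite (gammaMeasure a r) := by
  unfold gammaMeasure; infer_instance

/-- The inner substitution: for `y > 0` and measurable `g`,
`∫_{(0,∞)} γ_a(x) g(x/(x+y)) dx = ∫_{(0,1)} y/(1−s)² · γ_a(ys/(1−s)) · g(s) ds`. -/
theorem lintegral_gamma_comp_ratio {y : ℝ} (hy : 0 < y) (a : ℝ) (g : ℝ → ℝ≥0∞) :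
    ∫⁻ x in Ioi 0, ENNReal.ofReal (x ^ (a - 1) * Real.exp (-x) / Real.Gamma a) * g (x / (x + y)) =
      ∫⁻ s in Ioo 0 1, ENNReal.ofReal (y / (1 - s) ^ 2) *
        (ENNReal.ofReal ((ratioSub y s) ^ (a - 1) * Real.exp (-(ratioSub y s)) / Real.Gamma a) * g s) := by
  have hderiv : ∀ s ∈ Ioo (0 : ℝ) 1, HasDerivWithinAt (ratioSub y) (y / (1 - s) ^ 2) (Ioo 0 1) s :=
    fun s hs => (hasDerivAt_ratioSub y (ne_of_lt hs.2)).hasDerivWithinAt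
  rw [← image_ratioSub hy, lintegral_image_eq_lintegral_abs_deriv_mul measurableSet_Ioo hderiv (injOn_ratioSub hy)]
  refine setLIntegral_congr_fun measurableSet_Ioo fun s hs => ?_
  rw [abs_of_pos (div_pos hy (pow_pos (by linarith [hs.2]) 2)), ratioSub_div hy hs.2]

/-- The joint integrand after the inner substitution: `γ_b(y) · (y/(1−s)² · (γ_a(ys/(1−s)) · g s))`. -/
noncomputable def bgIntegrand (a b : ℝ) (g : ℝ → ℝ≥0∞) (y s : ℝ) : ℝ≥0∞ :=
  ENNReal.ofReal (y ^ (b - 1) * Real.exp (-y) / Real.Gamma b) *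
    (ENNReal.ofReal (y / (1 - s) ^ 2) *
      (ENNReal.ofReal ((ratioSub y s) ^ (a - 1) * Real.exp (-(ratioSub y s)) / Real.Gamma a) * g s))

/-- The joint integrand is jointly measurable. -/
theorem measurable_bgIntegrand (a b : ℝ) {g : ℝ → ℝ≥0∞} (hg : Measurable g) :
    Measurable (Function.uncurry (bgIntegrand a b g)) := by
  unfold bgIntegrand ratioSub Function.uncurry
  fun_prop

/-- On `y > 0`, `0 < s < 1` the joint integrand is `s^{a−1}(1−s)^{b−1}/B(a,b) · γ_{a+b,1/(1−s)}(y) · g s`. -/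
theorem bgIntegrand_eq (ha : 0 < a) (hb : 0 < b) {g : ℝ → ℝ≥0∞} {y s : ℝ} (hy : 0 < y)
    (hs : s ∈ Ioo (0 : ℝ) 1) :
    bgIntegrand a b g y s =
      ENNReal.ofReal (s ^ (a - 1) * (1 - s) ^ (b - 1) / beta a b) * gammaPDF (a + b) (1 / (1 - s)) y * g s := by
  have hs1 : 0 < 1 - s := by linarith [hs.2]
  have hC : 0 ≤ s ^ (a - 1) * (1 - s) ^ (b - 1) / beta a b :=
    div_nonneg (mul_nonneg (Real.rpow_nonneg hs.1.le _) (Real.rpow_nonneg hs1.le _)) (beta_pos ha hb).le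
  have hγb : 0 ≤ y ^ (b - 1) * Real.exp (-y) / Real.Gamma b :=
    div_nonneg (mul_nonneg (Real.rpow_nonneg hy.le _) (Real.exp_pos _).le) (Real.Gamma_pos_of_pos hb).le
  have hJ : 0 ≤ y / (1 - s) ^ 2 := div_nonneg hy.le (sq_nonneg _)
  have hγa : 0 ≤ (ratioSub y s) ^ (a - 1) * Real.exp (-(ratioSub y s)) / Real.Gamma a :=
    div_nonneg (mul_nonneg (Real.rpow_nonneg (div_pos (mul_pos hy hs.1) hs1).le _) (Real.exp_pos _).le)
      (Real.Gamma_pos_of_pos ha).le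
  rw [bgIntegrand, ← mul_assoc, ← mul_assoc, ← ENNReal.ofReal_mul hγb, ← ENNReal.ofReal_mul (mul_nonneg hγb hJ),
    gammaPDF_of_nonneg hy.le, ← ENNReal.ofReal_mul hC]
  congr 2
  unfold ratioSub
  exact betaGamma_pointwise ha hb hy hs

/-- **The law of `x/(x+y)` for independent `x ∼ Gamma(a,1)`, `y ∼ Gamma(b,1)`**: for measurable
`g ≥ 0`, `∫ g(x/(x+y)) = ∫_{(0,1)} s^{a−1}(1−s)^{b−1}/B(a,b) · g(s) ds`. -/
theorem lintegral_ratio_gammaMeasure (ha : 0 < a) (hb : 0 < b) {g : ℝ → ℝ≥0∞} (hg : Measurable g) :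
    ∫⁻ p, g (p.1 / (p.1 + p.2)) ∂((gammaMeasure a 1).prod (gammaMeasure b 1)) =
      ∫⁻ s in Ioo 0 1, ENNReal.ofReal (s ^ (a - 1) * (1 - s) ^ (b - 1) / beta a b) * g s := by
  have hmeas : Measurable fun p : ℝ × ℝ => g (p.1 / (p.1 + p.2)) :=
    hg.comp (measurable_fst.div (measurable_fst.add measurable_snd))
  have hFm := measurable_bgIntegrand a b hg
  rw [lintegral_prod_symm _ hmeas.aemeasurable, lintegral_gammaMeasure_one b hmeas.lintegral_prod_left']
  -- the inner `x`-integral against Gamma(a,1) and the substitution, for each `y > 0`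
  have hinner : ∀ y ∈ Ioi (0 : ℝ),
      ENNReal.ofReal (y ^ (b - 1) * Real.exp (-y) / Real.Gamma b) * ∫⁻ x, g (x / (x + y)) ∂(gammaMeasure a 1) =
        ∫⁻ s in Ioo 0 1, bgIntegrand a b g y s := by
    intro y hy
    have hgy : Measurable fun x : ℝ => g (x / (x + y)) := by fun_prop
    have hFy : Measurable fun s : ℝ => ENNReal.ofReal (y / (1 - s) ^ 2) *
        (ENNReal.ofReal ((ratioSub y s) ^ (a - 1) * Real.exp (-(ratioSub y s)) / Real.Gamma a) * g s) := by
      unfold ratioSub; fun_prop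
    rw [lintegral_gammaMeasure_one a hgy, lintegral_gamma_comp_ratio hy a g, ← lintegral_const_mul _ hFy]
    rfl
  rw [setLIntegral_congr_fun measurableSet_Ioi hinner,
    lintegral_lintegral_swap hFm.aemeasurable]
  refine setLIntegral_congr_fun measurableSet_Ioo fun s hs => ?_
  -- the `y`-integral for fixed `s`: a Gamma(a+b) law at rate `1/(1−s)` integrates to one
  have hs1 : 0 < 1 - s := by linarith [hs.2]
  have hm2 : Measurable (gammaPDF (a + b) (1 / (1 - s))) := (measurable_gammaPDFReal _ _).ennreal_ofReal
  have hm1 : Measurable fun y : ℝ =>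
      ENNReal.ofReal (s ^ (a - 1) * (1 - s) ^ (b - 1) / beta a b) * gammaPDF (a + b) (1 / (1 - s)) y :=
    measurable_const.mul hm2
  rw [setLIntegral_congr_fun measurableSet_Ioi (fun y hy => bgIntegrand_eq ha hb hy hs),
    lintegral_mul_const _ hm1, lintegral_const_mul _ hm2,
    lintegral_Ioi_gammaPDF (add_pos ha hb) (div_pos one_pos hs1), mul_one]

/-- Integrating against `betaMeasure a b` is integrating `s^{a−1}(1−s)^{b−1}/B(a,b)` over `(0,1)`. -/
theorem lintegral_betaMeasure (a b : ℝ) {g : ℝ → ℝ≥0∞} (hg : Measurable g) :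
    ∫⁻ s, g s ∂(betaMeasure a b) =
      ∫⁻ s in Ioo 0 1, ENNReal.ofReal (s ^ (a - 1) * (1 - s) ^ (b - 1) / beta a b) * g s := by
  have hpdf : Measurable (betaPDF a b) := (measurable_betaPDFReal a b).ennreal_ofReal
  rw [betaMeasure, lintegral_withDensity_eq_lintegral_mul _ hpdf hg, ← lintegral_indicator measurableSet_Ioo]
  refine lintegral_congr fun s => ?_
  by_cases hs : s ∈ Ioo (0 : ℝ) 1
  · rw [indicator_of_mem hs, Pi.mul_apply, betaPDF_of_pos_lt_one hs.1 hs.2]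
    congr 2
    ring
  · rw [indicator_of_notMem hs, Pi.mul_apply, betaPDF_eq, if_neg (by simpa [mem_Ioo] using hs),
      ENNReal.ofReal_zero, zero_mul]

/-- **THE BETA PRIMITIVE IS EXACT.**  For `a, b > 0`, if `x ∼ Gamma(a,1)` and `y ∼ Gamma(b,1)` are
independent then `x/(x+y) ∼ Beta(a,b)`:
`(gammaMeasure a 1 ⊗ gammaMeasure b 1).map (x,y ↦ x/(x+y)) = betaMeasure a b`. -/
theorem map_ratio_gammaMeasure_prod (ha : 0 < a) (hb : 0 < b) :
    ((gammaMeasure a 1).prod (gammaMeasure b 1)).map (fun p : ℝ × ℝ => p.1 / (p.1 + p.2)) = betaMeasure a b := by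
  have hratio : Measurable fun p : ℝ × ℝ => p.1 / (p.1 + p.2) := by fun_prop
  refine Measure.ext_of_lintegral _ fun g hg => ?_
  rw [lintegral_map hg hratio, lintegral_ratio_gammaMeasure ha hb hg, lintegral_betaMeasure a b hg]

/-- **The engine's case** (`rng_beta_sym(a) = x/(x+y)`, two `rng_gamma(a)` draws): the symmetric
`Beta(a,a)` law, for every `a > 0` — in `WoodSampler.lean` `a = δ/2 = (d−1)/2`. -/
theorem map_ratio_gammaMeasure_prod_self (ha : 0 < a) :
    ((gammaMeasure a 1).prod (gammaMeasure a 1)).map (fun p : ℝ × ℝ => p.1 / (p.1 + p.2)) = betaMeasure a a :=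
  map_ratio_gammaMeasure_prod ha ha

end BetaGamma

end Summit.Ventures.LatticeQCDFlow.Exactness
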